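import Summits.ResolutionOfSingularities.ResolutionOfSingularities.Theorems.UniversalCellsLocalToGlobalTwoModelPatchingAt
import Literature.AlgebraicGeometry.Resolution.ProperModelsExtension
import Literature.AlgebraicGeometry.Morphisms.NagataCompactificationProofs
import Literature.AlgebraicGeometry.Resolution.ProperModelsRegLeification
import Literature.AlgebraicGeometry.Resolution.AlterationsResolution
import HarnessLib

/-!
# Route CleanCovers — crux `CoverResolution` (stmt-ResolutionOfSingularities-15104), line
# `strategy-split` (v2): stub `stub_binaryPatchingOverField`

Binary patching of resolvable opens over a field with Zariski two-model patching. Let `k` be a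
field such that any two proper models of any function field `K/k` (essentially of finite type)
are dominated by a proper model `RegLe` over both, `X` an integral separated `k`-scheme of finite
type and `X = U ∪ V` an open cover by two opens each admitting a resolution of singularities. Then
`X` admits a resolution of singularities.

Proof, in two steps, both with field-agnostic proofs already in the tree over `𝔽_p`:

* `exists_integral_partialResolution_of_hasResolution_opens` — extension of a resolution
  `g : Y → U` of an open `U ⊆ X` to a proper birational `π : Z → X` with `Z` INTEGRAL and regular
  at every point over `U`: if `U = ∅` take `π = 𝟙 X`; otherwise `Y` is integral, and Nagata's
  compactification theorem (PROVED in the tree, `NagataCompactification_holds`) with the closure of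
  the graph gives `Z` integral, `ρ : Z → X` proper and a dense open immersion `s : Y → Z` with
  `Y = Z ×_X U` (`exists_isPullback_of_nagata`); regularity over `U` transfers along `s`
  (`isRegularLocalRing_stalk_of_isPullback_ι`) and `ρ` is an isomorphism over the image of the
  iso-locus of `g` (`isIso_morphismRestrict_image_of_isPullback`).
* `stub_binaryPatchingOverField` — apply the extension at `U` and at `V` and patch the two
  integral proper birational models by `hasResolution_of_twoModelPatchingAt_of_cover`.
-/

-- single-problem summit: the doubled namespace component `ResolutionOfSingularities` is forced
set_option linter.dupNamespace false

noncomputable section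

open CategoryTheory AlgebraicGeometry TopologicalSpace
open Literature.AlgebraicGeometry.Resolution Literature.AlgebraicGeometry.Morphisms

namespace Summit.ResolutionOfSingularities.ResolutionOfSingularities.Theorems

/-- **Extension of a local resolution to a partial resolution of `X` over `U`** (Nagata 1962,
Main Theorem; Conrad 2007, Thm. 4.1, followed by the closure of the graph). For a field `k`, an
integral `k`-scheme `X` of finite type and an open `U ⊆ X` admitting a resolution of
singularities, there is a proper birational `π : Z → X` with `Z` integral such that `𝒪_{Z,z}` is
a regular local ring for every `z` with `π z ∈ U`.
[cite: Nagata1962, Main Theorem; Conrad2007, Thm. 4.1] -/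
theorem exists_integral_partialResolution_of_hasResolution_opens (k : Type) [Field k]
    (X : Scheme.{0}) (f : X ⟶ Spec (.of k)) [LocallyOfFiniteType f] [QuasiCompact f]
    [IsIntegral X] (U : X.Opens) (hU : Scheme.HasResolution (U : Scheme.{0})) :
    ∃ (Z : Scheme.{0}) (π : Z ⟶ X), IsIntegral Z ∧ IsProper π ∧ IsBirational π ∧
      ∀ z : Z, π.base z ∈ U → IsRegularLocalRing (Z.presheaf.stalk z) := by
  -- `X` is Noetherian (of finite type over the field `k`)
  haveI : IsLocallyNoetherian X := LocallyOfFiniteType.isLocallyNoetherian f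
  haveI : CompactSpace X := QuasiCompact.compactSpace_of_compactSpace f
  haveI : IsNoetherian X := {}
  obtain ⟨Y, g, hg⟩ := hU
  by_cases hUne : (U : Set X).Nonempty
  · -- `U ≠ ∅`: `U` and `Y` are integral
    haveI : Nonempty (U : Scheme.{0}) := by
      obtain ⟨x, hx⟩ := hUne
      exact ⟨⟨x, hx⟩⟩
    haveI : IsIntegral (U : Scheme.{0}) := isIntegral_of_isOpenImmersion U.ι
    haveI : IsReduced Y := hg.isRegular.isReduced
    haveI : IsIntegral Y := hg.isBirational.isIntegral
    haveI : IsProper g := hg.isProper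
    -- Nagata compactification + closure of the graph: `Y = Z ×_X U`, `Z` integral, `ρ` proper
    obtain ⟨Z, ρ, s, hZ, hρ, hsI, -, hsq⟩ :=
      exists_isPullback_of_nagata NagataCompactification_holds U g
    haveI := hZ
    haveI := hρ
    haveI := hsI
    refine ⟨Z, ρ, hZ, hρ, ?_, ?_⟩
    · -- birationality: `ρ` is an isomorphism over the image of the iso-locus `O` of `g`
      obtain ⟨O, hOd, hOpre, hOiso⟩ := hg.isBirational
      haveI := hOiso
      haveI : IsIso (ρ ∣_ (U.ι ''ᵁ O)) := isIso_morphismRestrict_image_of_isPullback hsq O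
      refine ⟨U.ι ''ᵁ O, ?_, ?_, inferInstance⟩
      · exact (U.ι ''ᵁ O).isOpen.dense (nonempty_image_ι U hOd.nonempty)
      · refine (ρ ⁻¹ᵁ (U.ι ''ᵁ O)).isOpen.dense ?_
        obtain ⟨y, hy⟩ := hOpre.nonempty
        refine ⟨s.base y, ?_⟩
        show ρ.base (s.base y) ∈ U.ι ''ᵁ O
        rw [← Scheme.Hom.comp_apply, hsq.w, Scheme.Hom.comp_apply]
        exact ⟨g.base y, hy, rfl⟩
    · -- regularity over `U` transfers from `Y` along the open immersion `s`
      intro z hz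
      exact isRegularLocalRing_stalk_of_isPullback_ι hsq (S := (U : Set X)) subset_rfl
        (fun n _ => hg.isRegular n) z hz
  · -- `U = ∅`: the identity of `X` is a partial resolution over `U`
    refine ⟨X, 𝟙 X, inferInstance, inferInstance, ⟨⊤, by simp, by simp, inferInstance⟩, ?_⟩
    intro z hz
    exact absurd ⟨_, hz⟩ hUne

/-- **Binary patching of resolvable opens over a field with two-model patching** (Zariski 1944,
Fundamental Theorem p. 539, in the form of Piltant 2013, Prop. 5.1). Let `k` be a field over
which any two proper models of a function field are dominated by a proper model `RegLe` over
both. If `X` is an integral separated `k`-scheme of finite type and `X = U ∪ V` with `U` and `V`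
admitting resolutions of singularities, then `X` admits a resolution of singularities: extend
both resolutions to integral proper birational models of `X` regular over `U`, resp. `V`
(`exists_integral_partialResolution_of_hasResolution_opens`), and patch them
(`hasResolution_of_twoModelPatchingAt_of_cover`).
[cite: Zariski1944, Fundamental Theorem p. 539; Piltant2013, Prop. 5.1] -/
theorem stub_binaryPatchingOverField : ∀ (k : Type) [Field k], (∀ (K : Type) [Field K] [Algebra k K] [Algebra.EssFiniteType k K] (M₁ M₂ : Literature.AlgebraicGeometry.Resolution.ProperModel k K), ∃ (N : Literature.AlgebraicGeometry.Resolution.ProperModel k K) (φ₁ : N.Hom M₁) (φ₂ : N.Hom M₂), φ₁.RegLe ∧ φ₂.RegLe) → ∀ (X : AlgebraicGeometry.Scheme.{0}) (g : X ⟶ AlgebraicGeometry.Spec (.of k)), AlgebraicGeometry.IsSeparated g → AlgebraicGeometry.LocallyOfFiniteType g → AlgebraicGeometry.QuasiCompact g → AlgebraicGeometry.IsIntegral X → ∀ U V : X.Opens, U ⊔ V = ⊤ → Literature.AlgebraicGeometry.Resolution.Scheme.HasResolution (U : AlgebraicGeometry.Scheme.{0}) → Literature.AlgebraicGeometry.Resolution.Scheme.HasResolution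 (V : AlgebraicGeometry.Scheme.{0}) → Literature.AlgebraicGeometry.Resolution.Scheme.HasResolution X := by
  intro k _ hT X g hs hl hq hi U V hUV hU hV
  haveI := hs
  haveI := hl
  haveI := hq
  haveI := hi
  -- extend the two local resolutions to integral proper birational models of `X`
  obtain ⟨Z₁, π₁, hZ₁, hπ₁, hb₁, hr₁⟩ :=
    exists_integral_partialResolution_of_hasResolution_opens k X g U hU
  obtain ⟨Z₂, π₂, hZ₂, hπ₂, hb₂, hr₂⟩ :=
    exists_integral_partialResolution_of_hasResolution_opens k X g V hV
  haveI := hZ₁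
  haveI := hπ₁
  haveI := hZ₂
  haveI := hπ₂
  -- patch them by two-model patching of proper models over `k`
  exact hasResolution_of_twoModelPatchingAt_of_cover (k := k) hT X g U V hUV π₁ π₂ hb₁ hb₂ hr₁ hr₂

end Summit.ResolutionOfSingularities.ResolutionOfSingularities.Theorems

end
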